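import Summits.CriticalPhenomena.PercolationContinuityZ3.Theorems.PercNearOneGluingNoHeavyQuantFlowUncross
import HarnessLib

/-!
# QUANT lane R8, T-DEC: the CAPACITY INEQUALITY of one low atom extracted from a DEC datum (weak duality priced at a single low), and its
# two specialisations — the layer-`λ*` giant capacity `u_x·ν_l ≤ ν(> λ)` and the giant-only (criterion-E-type) bound

builds on p205010 (kernel theorem, internal audit signed; external expert review pending)

Support file (`--supports stmt-CriticalPhenomena-4575`), QUANT lane lead seat prim-quant-lead (gen 22), rung R8 of
`run/shared/lean/prim/quant/LADDER.md`; memo `run/shared/lean/prim/quant/prim-quant-lead-g22/LEAD-NOTES-G22.md` N48 (3) (the single-low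
blueprint: the two hypotheses (H_j′), (H_λ*) are exactly the capacity inequalities below at the layers `j′` and `λ*`).  Theorems only, standard
axioms, no sorries.  Uses typer g22/g23's `LawDec.dual_le_of_decAtT` (weak duality) and `LawDec.usage_pos_of_compat`.

* **`LawDec.low_capacity_of_decAtT`** — if `μ` is DEC(j′) at target `T` (floor `0 < x < 1`) and `l ≤ j′` is a low atom (`2l < T`), then
  `(x/(1−x))·μ l ≤ Σ_{h ≤ M} c_h·μ h` with `c_h = 1` for giants `h ≥ j′+1`, `c_h = (x/(1−x))/usage(l,h)` for compatible mids (`T ≤ 2h`, `T < l+h`),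
  `c_h = 0` otherwise: the absorbers can carry `l` ALONE (price system `α = x/(1−x)` at `l`, `0` at the other lows; `β = c`).
* **`LawDec.low_giantCapacity_of_decAtT`** — if moreover every CHARGED mid `h ≤ j′` is incompatible with `l` (`l + h ≤ T`; e.g. the band atoms
  of N48's geometry lemma `band_deep_incompatible`), then `(x/(1−x))·μ l ≤ Σ_{j′ < h ≤ M} μ h` — the hypothesis (H_λ*) of the single-low blueprint.

[this work]; DEC rules ARCH-TREES-G49 §2.2 / DEC-TAMP-G50 §3.1 (this lane).  The gluing rows served [cite: KozmaNitzan2024, Conjecture 3 (p. 15)];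
product measure [cite: Grimmett1999, §1.3 p. 10].
-/

noncomputable section

namespace Summit.CriticalPhenomena.PercolationContinuityZ3.Theorems

namespace Quant

open Finset

namespace LawDec

/-- the capacity coefficient of atom `h` for the low `l` at `(x, T, j′)`: `1` for a giant, `(x/(1−x))/usage` for a compatible mid, `0` otherwise. -/
def capCoef (x T : ℝ) (j' l h : ℕ) : ℝ :=
  if j' + 1 ≤ h then 1 else if T ≤ 2 * (h : ℝ) ∧ T < (l : ℝ) + h then (x / (1 - x)) / usage x T j' l h else 0

/-- `capCoef` is nonnegative (`0 < x < 1`, `2l < T`). [this work] -/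
theorem capCoef_nonneg (x T : ℝ) (j' l h : ℕ) (hx0 : 0 < x) (hx1 : x < 1) (hlow : 2 * (l : ℝ) < T) : 0 ≤ capCoef x T j' l h := by
  unfold capCoef
  split_ifs with hg hm
  · exact zero_le_one
  · have hlh : l < h := by
      have : (l : ℝ) < h := by linarith [hm.2]
      exact_mod_cast this
    have hu := usage_pos_of_compat x T j' l h hx0 hx1 hlow hlh (Or.inr hm.2)
    exact div_nonneg (div_nonneg hx0.le (by linarith)) hu.le
  · exact le_rfl

/-- **THE CAPACITY INEQUALITY OF ONE LOW ATOM.**  If `μ` is DEC(j′) at target `T` on `{0..M}` (floor `0 < x < 1`) and `l ≤ j′`, `2l < T`, then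
`(x/(1−x))·μ l ≤ Σ_{h ≤ M} capCoef(h)·μ h` — weak duality (`dual_le_of_decAtT`) with the price system `α_l = x/(1−x)`, `α = 0` at the other lows,
`β = capCoef`. [this work] -/
theorem low_capacity_of_decAtT (x T : ℝ) (j' M l : ℕ) (μ : ℕ → ℝ) (hx0 : 0 < x) (hx1 : x < 1) (hμ0 : ∀ h, 0 ≤ μ h)
    (hdec : DECAtT x T j' M μ) (hlj : l ≤ j') (hlow : 2 * (l : ℝ) < T) :
    x / (1 - x) * μ l ≤ ∑ h ∈ Finset.range (M + 1), capCoef x T j' l h * μ h := by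
  classical
  have hux : 0 < x / (1 - x) := div_pos hx0 (by linarith)
  -- the price system
  have hdual := dual_le_of_decAtT x T j' M μ hx0 hx1 hdec (fun l' => if l' = l then x / (1 - x) else 0) (capCoef x T j' l)
    (fun h => capCoef_nonneg x T j' l h hx0 hx1 hlow) ?_
  · -- evaluate both sides
    have lhs : ∑ l' ∈ Finset.range (j' + 1), (if 2 * (l' : ℝ) < T then (if l' = l then x / (1 - x) else 0) * μ l' else 0)
        = x / (1 - x) * μ l := by
      rw [Finset.sum_eq_single l]
      · rw [if_pos hlow, if_pos rfl]
      · intro l' _ hne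
        rw [if_neg hne, zero_mul]
        split_ifs <;> rfl
      · intro hnot
        exact absurd (Finset.mem_range.2 (Nat.lt_succ_of_le hlj)) hnot
    rw [lhs] at hdual
    refine hdual.trans (Finset.sum_le_sum fun h _ => ?_)
    split_ifs with hlowh
    · exact mul_nonneg (capCoef_nonneg x T j' l h hx0 hx1 hlow) (hμ0 h)
    · exact le_rfl
  · -- admissibility of the prices on compatible pairs
    intro l' h hl'j hl'low hhM hcomp
    by_cases hl' : l' = l
    · subst hl'
      rw [if_pos rfl]
      unfold capCoef
      rcases hcomp with hg | hm
      · rw [if_pos hg, usage_giant_eq x T j' l' h hg, mul_one]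
      · by_cases hg : j' + 1 ≤ h
        · rw [if_pos hg, usage_giant_eq x T j' l' h hg, mul_one]
        · rw [if_neg hg]
          have hT2h : T ≤ 2 * (h : ℝ) := by
            -- a compatible non-giant absorber is a mid: h ≤ j′ and h not low; from T < l' + h and 2l' < T we get l' < h; if 2h < T then
            -- l' + h < T/2 + T/2 = T, contradiction
            by_contra hlt
            have hlt' := not_le.1 hlt
            linarith
          rw [if_pos ⟨hT2h, hm⟩]
          have hlh : l' < h := by
            have : (l' : ℝ) < h := by linarith
            exact_mod_cast this
          have hu := usage_pos_of_compat x T j' l' h hx0 hx1 hl'low hlh (Or.inr hm)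
          rw [mul_comm, div_mul_cancel₀ _ hu.ne']
    · rw [if_neg hl']
      exact mul_nonneg (le_of_lt (by
        have hlh : l' < h := by
          rcases hcomp with hg | hm
          · omega
          · have : (l' : ℝ) < h := by linarith
            exact_mod_cast this
        exact usage_pos_of_compat x T j' l' h hx0 hx1 hl'low hlh hcomp)) (capCoef_nonneg x T j' l h hx0 hx1 hlow)

/-- **GIANT CAPACITY AT A LAYER WHERE NO CHARGED MID IS COMPATIBLE** (the hypothesis (H_λ*) of the single-low blueprint, N48 (3)): if `μ ≥ 0`
is DEC(j′) at target `T`, `l ≤ j′ ≤ M`, `2l < T`, and every charged atom `h ≤ j′` with `T ≤ 2h` has `l + h ≤ T` (incompatible — e.g. band atoms,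
`band_deep_incompatible`), then `(x/(1−x))·μ l ≤ Σ_{j′ < h ≤ M} μ h`. [this work] -/
theorem low_giantCapacity_of_decAtT (x T : ℝ) (j' M l : ℕ) (μ : ℕ → ℝ) (hx0 : 0 < x) (hx1 : x < 1) (hμ0 : ∀ h, 0 ≤ μ h)
    (hdec : DECAtT x T j' M μ) (hlj : l ≤ j') (hjM : j' ≤ M) (hlow : 2 * (l : ℝ) < T)
    (hincomp : ∀ h, h ≤ j' → T ≤ 2 * (h : ℝ) → 0 < μ h → (l : ℝ) + h ≤ T) :
    x / (1 - x) * μ l ≤ ∑ h ∈ Finset.Ico (j' + 1) (M + 1), μ h := by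
  classical
  have hcap := low_capacity_of_decAtT x T j' M l μ hx0 hx1 hμ0 hdec hlj hlow
  refine hcap.trans (le_of_eq ?_)
  -- every term with h ≤ j′ vanishes; giants have coefficient 1
  rw [Finset.range_eq_Ico, ← Finset.sum_Ico_consecutive _ (Nat.zero_le (j' + 1)) (by omega : j' + 1 ≤ M + 1)]
  have hz : ∑ h ∈ Finset.Ico 0 (j' + 1), capCoef x T j' l h * μ h = 0 := by
    refine Finset.sum_eq_zero fun h hh => ?_
    have hhj : h ≤ j' := Nat.lt_succ_iff.1 (Finset.mem_Ico.1 hh).2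
    unfold capCoef
    rw [if_neg (by omega)]
    by_cases hm : T ≤ 2 * (h : ℝ) ∧ T < (l : ℝ) + h
    · rw [if_pos hm]
      rcases (hμ0 h).eq_or_lt with hzero | hpos
      · rw [← hzero, mul_zero]
      · exact absurd (hincomp h hhj hm.1 hpos) (not_le.2 hm.2)
    · rw [if_neg hm, zero_mul]
  have hg : ∑ h ∈ Finset.Ico (j' + 1) (M + 1), capCoef x T j' l h * μ h = ∑ h ∈ Finset.Ico (j' + 1) (M + 1), μ h := by
    refine Finset.sum_congr rfl fun h hh => ?_
    unfold capCoef
    rw [if_pos (Finset.mem_Ico.1 hh).1, one_mul]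
  rw [hz, zero_add, hg]

end LawDec

end Quant

end Summit.CriticalPhenomena.PercolationContinuityZ3.Theorems
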